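import Mathlib
import Summits.ValiantsHypothesis.ValiantsHypothesis.Theorems.LacunarySymmetroidMatrixDescartesCensusWindowFourWitnessCentre

/-!
# `MatrixDescartes` census — WINDOW-4 PARAMETRIC ROWS: log-linear three-way certificates (the scale-free form of the centre witnesses)

HONEST FRAMING.  Object-search cell `pub-symmetroid`, door-A target `DoorA26 := PosRootLawAt 2 6 19`
(stmt-ValiantsHypothesis-19979; OPEN, typed, never asserted).  Companion of `…CensusWindowFourWitnessCentre`.  There the witness is
a point `r`; here the point is tied to the coefficients (`r^v = λ·u·b/((u+v)·c)` on the left side, `r^w = μ·v(u+v)·c/((v+w)(u+v+w)·e)`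
on the right side), so that every hypothesis becomes a MONOMIAL inequality in the window coefficients `a, b, c, e` — i.e. a LOG-LINEAR ROW.
Read contrapositively: for every `λ > 1` (resp. admissible `μ, t`) a Descartes-sharp window satisfies the DISJUNCTION of the negations of
three log-linear rows — a three-way split usable verbatim by the cell's exact LP/domination trees, with no numeric band table; and the
`λ`-family covers the scale-free far pieces of the W4 tube (val-sym-door-p1 g9 README, witness-generator spec §4), where no fixed rational
witness exists.

* `fourNomial_card_posRoots_le_two_of_left_param` — `ρ = λ u b/((u+v) c)`:  `ρ^w·((v+w)(u+v+w)e)^v ≤ (v(u+v)c)^v`,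
  `((u+v+w)e)^v·ρ^(v+w) < ((λ−1)ub)^v`, `(vc)^v·ρ^(u+v) < (ua)^v`  ⇒ `#Z₊ ≤ 2`;
* `fourNomial_card_posRoots_le_two_of_right_param` — `ρ = μ v(u+v)c/((v+w)(u+v+w)e)`, `1 ≤ μ`, `0 < t`, `μ(u+v)/(u+v+w) + t < 1`:
  `((u+v)c)^w·ρ^v < (ub)^w`, `(ua)^w ≤ (tvc)^w·ρ^(u+v)`  ⇒ `#Z₊ ≤ 2`.

Nothing here bounds any census count; `DoorA26` OPEN; nothing on `MatrixDescartes` (stmt-ValiantsHypothesis-18050) or `VP ≠ VNP`.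

[folklore] `v`-th / `w`-th roots (`Real.rpow`) + the centre witness rows; elementary.
-/

-- `Summit.ValiantsHypothesis.ValiantsHypothesis.…` repeats a component by the D-0017 layout
-- (single-conjunct summit), which the `dupNamespace` linter flags; the name is mandated.
set_option linter.dupNamespace false

namespace Summit.ValiantsHypothesis.ValiantsHypothesis.Theorems.LacunarySymmetroidMatrixDescartes.Census

open Polynomial Finset Set
open scoped BigOperators Polynomial

/-- A positive real has a positive `n`-th root (`n ≥ 1`). [folklore] -/
theorem exists_pos_pow_eq {ρ : ℝ} (hρ : 0 < ρ) {n : ℕ} (hn : 0 < n) : ∃ r : ℝ, 0 < r ∧ r ^ n = ρ := by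
  refine ⟨ρ ^ ((n : ℝ)⁻¹), Real.rpow_pos_of_pos hρ _, ?_⟩
  exact Real.rpow_inv_natCast_pow hρ.le hn.ne'

/-- `x ≤ y` from `x^n ≤ y^n` for nonnegative reals, `n ≥ 1`. [folklore] -/
theorem le_of_pow_le_pow_left' {x y : ℝ} (hx : 0 ≤ x) (hy : 0 ≤ y) {n : ℕ} (hn : n ≠ 0) (h : x ^ n ≤ y ^ n) : x ≤ y :=
  (pow_le_pow_iff_left₀ hx hy hn).mp h

/-- `x < y` from `x^n < y^n` for nonnegative reals. [folklore] -/
theorem lt_of_pow_lt_pow_left' {x y : ℝ} (hy : 0 ≤ y) (n : ℕ) (h : x ^ n < y ^ n) : x < y :=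
  lt_of_pow_lt_pow_left₀ n hy h

/-- **PARAMETRIC LEFT ROW.**  `u, v, w ≥ 1`, `a, b, c, e > 0`, `λ` real, `ρ := λ·u·b/((u+v)·c) > 0`.  If the three monomial
inequalities `ρ^w·((v+w)(u+v+w)e)^v ≤ (v(u+v)c)^v` (the point `r = ρ^(1/v)` is at or left of the common centre),
`((u+v+w)e)^v·ρ^(v+w) < ((λ−1)ub)^v` (`T₂(r) < 0`) and `(vc)^v·ρ^(u+v) < (ua)^v` (`Φ(r) > 0`) hold, the window 4-nomial has at most
two positive roots. [folklore] -/
theorem fourNomial_card_posRoots_le_two_of_left_param {u v w : ℕ} (hu : 0 < u) (hv : 0 < v) (hw : 0 < w)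
    {a b c e lam : ℝ} (ha : 0 < a) (hb : 0 < b) (hc : 0 < c) (he : 0 < e) {ρ : ℝ} (hρ : 0 < ρ)
    (hρdef : ρ * (((u : ℝ) + v) * c) = lam * ((u : ℝ) * b))
    (h1 : ρ ^ w * ((((v : ℝ) + w) * ((u : ℝ) + v + w) * e)) ^ v ≤ ((v : ℝ) * ((u : ℝ) + v) * c) ^ v)
    (h2 : (((u : ℝ) + v + w) * e) ^ v * ρ ^ (v + w) < ((lam - 1) * ((u : ℝ) * b)) ^ v)
    (h2' : 0 ≤ (lam - 1) * ((u : ℝ) * b))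
    (h3 : ((v : ℝ) * c) ^ v * ρ ^ (u + v) < ((u : ℝ) * a) ^ v) :
    ((C a - C b * X ^ u + C c * X ^ (u + v) - C e * X ^ (u + v + w)).roots.toFinset.filter
      (fun x => 0 < x)).card ≤ 2 := by
  obtain ⟨r, hr, hrv⟩ := exists_pos_pow_eq hρ hv
  have hvne : v ≠ 0 := hv.ne'
  -- powers of r in terms of ρ
  have hrw : (r ^ w) ^ v = ρ ^ w := by rw [← pow_mul, mul_comm, pow_mul, hrv]
  have hrvw : (r ^ (v + w)) ^ v = ρ ^ (v + w) := by rw [← pow_mul, mul_comm, pow_mul, hrv]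
  have hruv : (r ^ (u + v)) ^ v = ρ ^ (u + v) := by rw [← pow_mul, mul_comm, pow_mul, hrv]
  -- centre: (v+w)(u+v+w) e r^w ≤ v(u+v) c
  have hcen : ((v : ℝ) + w) * ((u : ℝ) + v + w) * e * r ^ w ≤ (v : ℝ) * ((u : ℝ) + v) * c := by
    have hx : 0 ≤ ((v : ℝ) + w) * ((u : ℝ) + v + w) * e * r ^ w := by positivity
    have hy : 0 ≤ (v : ℝ) * ((u : ℝ) + v) * c := by positivity
    refine le_of_pow_le_pow_left' hx hy hvne ?_
    calc (((v : ℝ) + w) * ((u : ℝ) + v + w) * e * r ^ w) ^ v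
        = ρ ^ w * ((((v : ℝ) + w) * ((u : ℝ) + v + w) * e)) ^ v := by rw [mul_pow, hrw, mul_comm]
      _ ≤ ((v : ℝ) * ((u : ℝ) + v) * c) ^ v := h1
  -- T₂(r) < 0
  have hT : (u : ℝ) * b - ((u : ℝ) + v) * c * r ^ v + ((u : ℝ) + v + w) * e * r ^ (v + w) < 0 := by
    have hlt : ((u : ℝ) + v + w) * e * r ^ (v + w) < (lam - 1) * ((u : ℝ) * b) := by
      refine lt_of_pow_lt_pow_left' h2' v ?_
      calc (((u : ℝ) + v + w) * e * r ^ (v + w)) ^ v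
          = (((u : ℝ) + v + w) * e) ^ v * ρ ^ (v + w) := by rw [mul_pow, hrvw]
        _ < ((lam - 1) * ((u : ℝ) * b)) ^ v := h2
    have hmid : ((u : ℝ) + v) * c * r ^ v = lam * ((u : ℝ) * b) := by rw [hrv, mul_comm, hρdef]
    nlinarith
  -- Φ(r) > 0
  have hΦ : 0 < (u : ℝ) * a - (v : ℝ) * c * r ^ (u + v) + ((v : ℝ) + w) * e * r ^ (u + v + w) := by
    have hlt : (v : ℝ) * c * r ^ (u + v) < (u : ℝ) * a := by
      refine lt_of_pow_lt_pow_left' (by positivity) v ?_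
      calc ((v : ℝ) * c * r ^ (u + v)) ^ v = ((v : ℝ) * c) ^ v * ρ ^ (u + v) := by rw [mul_pow, hruv]
        _ < ((u : ℝ) * a) ^ v := h3
    have hpos : 0 < ((v : ℝ) + w) * e * r ^ (u + v + w) := by positivity
    linarith
  exact fourNomial_card_posRoots_le_two_of_left_centre_witness hu hv hw ha hb he hr hcen hT hΦ

/-- **PARAMETRIC RIGHT ROW.**  `u, v, w ≥ 1`, `a, b, c, e > 0`, `1 ≤ μ`, `0 < t` with `μ(u+v) + t(u+v+w) < u+v+w`,
`ρ := μ·v(u+v)c/((v+w)(u+v+w)e) > 0` (the point `r = ρ^(1/w)` is at or right of the common centre).  If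
`((u+v)c)^w·ρ^v < (ub)^w` (`T₂(r) > 0`) and `(ua)^w ≤ (tvc)^w·ρ^(u+v)` (then `Φ(r) < 0`) hold, the window 4-nomial has at most two
positive roots. [folklore] -/
theorem fourNomial_card_posRoots_le_two_of_right_param {u v w : ℕ} (hu : 0 < u) (hv : 0 < v) (hw : 0 < w)
    {a b c e mu t : ℝ} (ha : 0 < a) (hb : 0 < b) (hc : 0 < c) (he : 0 < e) (hmu : 1 ≤ mu) (ht : 0 < t)
    (hmut : mu * ((u : ℝ) + v) + t * ((u : ℝ) + v + w) < (u : ℝ) + v + w) {ρ : ℝ} (hρ : 0 < ρ)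
    (hρdef : ρ * (((v : ℝ) + w) * ((u : ℝ) + v + w) * e) = mu * ((v : ℝ) * ((u : ℝ) + v) * c))
    (h2 : (((u : ℝ) + v) * c) ^ w * ρ ^ v < ((u : ℝ) * b) ^ w)
    (h3 : ((u : ℝ) * a) ^ w ≤ (t * ((v : ℝ) * c)) ^ w * ρ ^ (u + v)) :
    ((C a - C b * X ^ u + C c * X ^ (u + v) - C e * X ^ (u + v + w)).roots.toFinset.filter
      (fun x => 0 < x)).card ≤ 2 := by
  obtain ⟨r, hr, hrw⟩ := exists_pos_pow_eq hρ hw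
  have hwne : w ≠ 0 := hw.ne'
  have hrv : (r ^ v) ^ w = ρ ^ v := by rw [← pow_mul, mul_comm, pow_mul, hrw]
  have hruv : (r ^ (u + v)) ^ w = ρ ^ (u + v) := by rw [← pow_mul, mul_comm, pow_mul, hrw]
  -- centre: v(u+v)c ≤ (v+w)(u+v+w) e r^w  (μ ≥ 1)
  have hkey : ((v : ℝ) + w) * ((u : ℝ) + v + w) * e * r ^ w = mu * ((v : ℝ) * ((u : ℝ) + v) * c) := by
    rw [hrw, mul_comm, hρdef]
  have hcen : (v : ℝ) * ((u : ℝ) + v) * c ≤ ((v : ℝ) + w) * ((u : ℝ) + v + w) * e * r ^ w := by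
    rw [hkey]
    have h0 : 0 ≤ (v : ℝ) * ((u : ℝ) + v) * c := by positivity
    nlinarith
  -- T₂(r) > 0  (drop the positive e-term)
  have hT : 0 < (u : ℝ) * b - ((u : ℝ) + v) * c * r ^ v + ((u : ℝ) + v + w) * e * r ^ (v + w) := by
    have hlt : ((u : ℝ) + v) * c * r ^ v < (u : ℝ) * b := by
      refine lt_of_pow_lt_pow_left' (by positivity) w ?_
      calc (((u : ℝ) + v) * c * r ^ v) ^ w = (((u : ℝ) + v) * c) ^ w * ρ ^ v := by rw [mul_pow, hrv]
        _ < ((u : ℝ) * b) ^ w := h2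
    have hpos : 0 < ((u : ℝ) + v + w) * e * r ^ (v + w) := by positivity
    linarith
  -- Φ(r) < 0
  have hΦ : (u : ℝ) * a - (v : ℝ) * c * r ^ (u + v) + ((v : ℝ) + w) * e * r ^ (u + v + w) < 0 := by
    have hle : (u : ℝ) * a ≤ t * ((v : ℝ) * c) * r ^ (u + v) := by
      have hx : 0 ≤ (u : ℝ) * a := by positivity
      have hy : 0 ≤ t * ((v : ℝ) * c) * r ^ (u + v) := by positivity
      refine le_of_pow_le_pow_left' hx hy hwne ?_
      calc ((u : ℝ) * a) ^ w ≤ (t * ((v : ℝ) * c)) ^ w * ρ ^ (u + v) := h3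
        _ = (t * ((v : ℝ) * c) * r ^ (u + v)) ^ w := by rw [← hruv, ← mul_pow]
    -- (v+w) e r^(u+v+w) = (v+w) e r^w * r^(u+v) = [μ v(u+v)c/(u+v+w)] r^(u+v)
    have hsplit : ((v : ℝ) + w) * e * r ^ (u + v + w)
        = (((v : ℝ) + w) * ((u : ℝ) + v + w) * e * r ^ w) * r ^ (u + v) / ((u : ℝ) + v + w) := by
      have hU : ((u : ℝ) + v + w) ≠ 0 := by positivity
      field_simp
      ring
    rw [hsplit, hkey]
    have hruvpos : 0 < r ^ (u + v) := by positivity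
    have hvc : 0 < (v : ℝ) * c := by positivity
    have hU : 0 < (u : ℝ) + v + w := by positivity
    -- goal: u a − v c r^(u+v) + μ v (u+v) c r^(u+v)/(u+v+w) < 0
    have hcoef : mu * ((u : ℝ) + v) / ((u : ℝ) + v + w) + t < 1 := by
      rw [div_add' _ _ _ hU.ne', div_lt_one hU]; linarith
    have : (u : ℝ) * a - (v : ℝ) * c * r ^ (u + v)
        + mu * ((v : ℝ) * ((u : ℝ) + v) * c) * r ^ (u + v) / ((u : ℝ) + v + w)
        ≤ ((v : ℝ) * c * r ^ (u + v)) * (t - 1 + mu * ((u : ℝ) + v) / ((u : ℝ) + v + w)) := by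
      have hexp : ((v : ℝ) * c * r ^ (u + v)) * (t - 1 + mu * ((u : ℝ) + v) / ((u : ℝ) + v + w))
          = t * ((v : ℝ) * c) * r ^ (u + v) - (v : ℝ) * c * r ^ (u + v)
            + mu * ((v : ℝ) * ((u : ℝ) + v) * c) * r ^ (u + v) / ((u : ℝ) + v + w) := by
        field_simp
      rw [hexp]; linarith
    have hneg : ((v : ℝ) * c * r ^ (u + v)) * (t - 1 + mu * ((u : ℝ) + v) / ((u : ℝ) + v + w)) < 0 := by
      apply mul_neg_of_pos_of_neg (by positivity)
      linarith
    linarith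
  exact fourNomial_card_posRoots_le_two_of_right_centre_witness hu hv hw ha hb he hr hcen hT hΦ

end Summit.ValiantsHypothesis.ValiantsHypothesis.Theorems.LacunarySymmetroidMatrixDescartes.Census
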